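import Literature.NumberTheory.Automorphic.LocalComponentBJGenericProofs
import Literature.NumberTheory.Automorphic.AutomorphicTwistBJ
import HarnessLib

/-!
# Local components of the twist `Π ⊗ (ω ∘ det)` of an automorphic representation of `GL_n(𝔸_K)`

Topic `Literature/NumberTheory/Automorphic`; proof file (theorems only: no definition, no named
fact, no instance).  For an automorphic representation `π` of `GL_n(𝔸_K)` (Borel–Jacquet datum),
a finite-order Hecke character `ω` and a finite place `v`: if `ρ` is a local component of `π` at
`v` (`HasLocalComponentAt`), then the LOCAL TWIST `ρ ⊗ (ω_v ∘ det)` — `ω_v = ω ∘ (K_vˣ ↪ 𝕀_K)`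
the local component of `ω` (`HeckeCharacter.localComponent`) — is a local component of the
GLOBAL TWIST `π ⊗ (ω ∘ det)` (`AutomorphicRepData.twist`, `CuspidalAutomorphicRepData.twist`) at
`v` (Jacquet–Langlands 1970, §§9–11, the local components of `χ ⊗ π`; Borel–Jacquet 1979, 4.6):
`HasLocalComponentAt.map_mulChar` (`LocalComponentBJGenericProofs`) with the computation
`(ω ∘ det)(ι_v g) = ω_v(det g)` (`GLn.det_ofLocal`).  This is the "local component of the twist"
entry of the dictionary used by clauses (R), (N), (G) of the standard `L`-function theory of
cuspidal `GL(2)` (`JacquetLanglands1970_standardLTheoryGL2`).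

## References

* H. Jacquet, R. P. Langlands, *Automorphic Forms on GL(2)*, LNM 114 (1970), §9, §11.
  [JacquetLanglands1970]
* A. Borel, H. Jacquet, *Automorphic forms and automorphic representations*, Corvallis 1979,
  4.6. [BorelJacquetCorvallis1979]
-/

noncomputable section

open scoped MatrixGroups NNReal Classical
open NumberField IsDedekindDomain MeasureTheory

namespace Literature.NumberTheory.Automorphic

variable {n : ℕ} {K : Type} [Field K] [NumberField K] {hcpt : isCompact_glFiniteIntegralLevel n K}

/-- `(ω ∘ det)(ι_v g) = ω_v (det g)` for `g ∈ GL_n(K_v)`. [folklore] -/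
theorem detTwist_ofLocal (ω : GaloisRepresentations.HeckeCharacter K) (v : HeightOneSpectrum (𝓞 K))
    (g : GL (Fin n) (v.adicCompletion K)) :
    detTwist n ω (GLn.ofLocal n K v g) = ω.localComponent v (Matrix.GeneralLinearGroup.det g) := by
  change ω (Matrix.GeneralLinearGroup.det (GLn.ofLocal n K v g)) =
    ω (GaloisRepresentations.localUnits v (Matrix.GeneralLinearGroup.det g))
  rw [GLn.det_ofLocal]

/-- **Local components of the global twist** (Jacquet–Langlands 1970, §§9, 11; Borel–Jacquet
1979, 4.6): if `ρ` is a local component of `π` at `v` then `ρ ⊗ (ω_v ∘ det)` is a local component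
of `π ⊗ (ω ∘ det)` at `v`. [cite: JacquetLanglands1970, §11] [cite: BorelJacquetCorvallis1979, 4.6] -/
theorem AutomorphicRepData.hasLocalComponentAt_twist
    (π : AutomorphicRepData (AutomorphyDatum.gl n K hcpt))
    (ω : GaloisRepresentations.HeckeCharacter K) (hω : ω.IsFiniteOrder) {v : HeightOneSpectrum (𝓞 K)}
    {V : Type*} [AddCommGroup V] [Module ℂ V]
    {ρ : Representation ℂ (GL (Fin n) (v.adicCompletion K)) V} (hρ : π.HasLocalComponentAt v ρ) :
    (π.twist ω hω).HasLocalComponentAt v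
      (ρ.twist ((ω.localComponent v).comp Matrix.GeneralLinearGroup.det)) :=
  hρ.map_mulChar (detTwist n ω) rfl rfl _ fun g => by
    rw [MonoidHom.comp_apply, detTwist_ofLocal]

/-- **Local components of the cuspidal twist `Π ⊗ (ω ∘ det)`**: if `ρ` is a local component of
the cuspidal `Π` at `v` then `ρ ⊗ (ω_v ∘ det)` is a local component of `Π.twist ω hω` at `v`.
[cite: JacquetLanglands1970, §11] [cite: BorelJacquetCorvallis1979, 4.6] -/
theorem CuspidalAutomorphicRepData.hasLocalComponentAt_twist
    (π : CuspidalAutomorphicRepData n K hcpt)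
    (ω : GaloisRepresentations.HeckeCharacter K) (hω : ω.IsFiniteOrder) {v : HeightOneSpectrum (𝓞 K)}
    {V : Type*} [AddCommGroup V] [Module ℂ V]
    {ρ : Representation ℂ (GL (Fin n) (v.adicCompletion K)) V} (hρ : π.1.HasLocalComponentAt v ρ) :
    (π.twist ω hω).1.HasLocalComponentAt v
      (ρ.twist ((ω.localComponent v).comp Matrix.GeneralLinearGroup.det)) :=
  AutomorphicRepData.hasLocalComponentAt_twist π.1 ω hω hρ

/-- The local twisting character is `ω_v ∘ det` (pointwise form, the hypothesis `hc` of the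
local `L`-factor theorems of `GL2LFactorTwistVanishing`). [folklore] -/
theorem localComponent_comp_det_apply (ω : GaloisRepresentations.HeckeCharacter K)
    (v : HeightOneSpectrum (𝓞 K)) (g : GL (Fin n) (v.adicCompletion K)) :
    ((ω.localComponent v).comp Matrix.GeneralLinearGroup.det) g =
      ω.localComponent v (Matrix.GeneralLinearGroup.det g) := rfl

end Literature.NumberTheory.Automorphic

end
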